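import Summits.Ventures.Crystal3D.TopCut.X2SOSExpand
import HarnessLib

/-!
# X2 cap certificates by sum-of-squares identities, II: the link to an `X2Cert` and the integer certificate

Venture `Crystal3D` (cell `pub-crystal3d`, phase 2; seat p2). Continuation of `TopCut/X2SOSExpand.lean`.

* `X2Link`, `linkCheckX` — link data (`N_k`, `s_k`, `Φᵃ`, `Φᵇ`) and the decidable LINK CHECK against an
  `X2Cert` `c` (seat p1's format): `a_{k,r} = Φᵃ[k][r]/N_k`, `b_{k,r} = Φᵇ[k][r]/N_k` as coefficient lists
  and `s_k · c_k · N_k² = DK`; then (`polePval_link`, `poleSval_link`) the expansions of part I evaluate to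
  `DK · (P - K)` and `DK · S₃` (`P = c.pairPoly`, `K = c.kernel`, `S₃ = c.tripleSym`); the cap kernel `K`
  itself is `CapSOS.capFPoly` (`CapSOS.capFval_link` applied to `c.cap`);
* `X2SOSCert` — the integer certificate: dyadic roundings `P' = PpI/2^B0`, `S₃' = SpI/2^B0` with bridges
  `Σ|2^B0 XI - DK·PpI| ≤ delB2`, `Σ|2^B0 SI - DK·SpI| ≤ delB3`, and the identities
  (II)  `lam2 (CI2 - PpI) - c2 ≡ E0 + (m_u+m_v)E1 + m_u m_v E2 + m_t E3 + gram E4 (± c2)`,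
  (III) `lam3 (CI3 - SpI) - c3 ≡ R0 + (n_u+n_v)R1 + n_u n_v R2 + m_t R3 + gram R4 (± c3)`,
  `m_u = (q₀u + p₀)(1-u)` (`u₀ = -p₀/q₀`), `m_t = (1+t)(1-2t)`, `n_u = (1+u)(1-2u)`,
  `gram = 1 + 2uvt - u² - v² - t²`, with Gram expansions `E_i, R_i` validated separately
  (`ThreePointCert.RValid`), plus the side conditions tying the constants to `λ`, `ε₃`.

Everything computational is `List`/`ℤ`/`ℕ` structural recursion (`decide +kernel`, standard axioms).
HONEST FRAMING: a checker [folklore]; NO certificate is asserted here; soundness is in `X2SOSSound.lean`.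
-/

noncomputable section

open Finset
open Literature.Geometry.DiscreteGeometry Literature.Geometry.DiscreteGeometry.PolyCert
open Literature.Geometry.DiscreteGeometry.PolyCert.SPoly
open Literature.Geometry.DiscreteGeometry.BachocVallentin
open Literature.Analysis.SpecialFunctions
open Summit.Ventures.PackingBounds.ThreePointCert
open Summit.Ventures.Crystal3D.CapSOS Summit.Ventures.Crystal3D.CapX2

namespace Summit.Ventures.Crystal3D.X2SOS

/-! ### The link to an `X2Cert` -/

/-- Link data for the pole blocks: denominators `N_k`, scales `s_k`, integer columns
`Φᵃ[k][r] = N_k · a_{k,r}`, `Φᵇ[k][r] = N_k · b_{k,r}` (coefficient lists). [folklore] -/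
structure X2Link where
  /-- `N_k` -/
  N : List ℕ
  /-- `s_k` -/
  S : List ℕ
  /-- `Φᵃ[k][r]` -/
  PhiA : List (List (List ℤ))
  /-- `Φᵇ[k][r]` -/
  PhiB : List (List (List ℤ))

/-- The pole block list a link defines for `KX` blocks and column bound `RX`. [folklore] -/
def X2Link.blocks (L : X2Link) (KX RX : ℕ) : List PoleBlk :=
  (List.range KX).map fun k => ⟨k, L.S.getD k 0,
    (List.range RX).map fun r => ((L.PhiA.getD k []).getD r [], (L.PhiB.getD k []).getD r [])⟩

/-- The LINK CHECK of an `X2Cert` against pole link data and the global denominator `DK`: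
for every `k < KX`: `0 < N_k`, `s_k · c_k · N_k² = DK`, and for every `r < RX`,
`a_{k,r} = Φᵃ[k][r]/N_k`, `b_{k,r} = Φᵇ[k][r]/N_k` as coefficient lists. [folklore] -/
def linkCheckX (c : X2Cert) (L : X2Link) (DK : ℕ) : Bool :=
  (List.range c.KX).all fun k =>
    decide (0 < L.N.getD k 0) && decide (L.S.getD k 0 * cfac3 k * L.N.getD k 0 ^ 2 = DK) &&
    ((List.range c.RX).all fun r =>
      eqScaled (L.N.getD k 0) ((L.PhiA.getD k []).getD r []) (aPolyN c k r (c.rowsX k)) &&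
      eqScaled (L.N.getD k 0) ((L.PhiB.getD k []).getD r []) (bPolyN c k r (c.rowsX k)))

/-- `((w.sum : ℤ) : ℝ) = φ_w(1)`. [folklore] -/
theorem cast_sum_eq_phiW_one (w : List ℤ) : ((w.sum : ℤ) : ℝ) = phiW w 1 := (phiW_one w).symm

/-- **The pair link**: under `linkCheckX`, the pole pair expansion evaluates to `DK · (P - K)`. [folklore] -/
theorem polePval_link (c : X2Cert) (L : X2Link) (DK : ℕ) (h : linkCheckX c L DK = true)
    (u v t : ℝ) : polePval (L.blocks c.KX c.RX) u v t =
      (DK : ℝ) * (c.pairPoly u v t - c.kernel u v t) := by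
  simp only [linkCheckX, List.all_eq_true, List.mem_range, Bool.and_eq_true, decide_eq_true_eq] at h
  have eP : c.pairPoly u v t - c.kernel u v t =
      c.S11 1 t t + c.S11 t 1 t + c.S11 t t 1 + c.S12 t (-u) (-v) + c.S12 t (-v) (-u) := by
    rw [X2Cert.pairPoly]; ring
  rw [eP, X2Cert.S11, X2Cert.S12, poleKernel3, poleKernel3, poleKernel3, poleKernel3, poleKernel3,
    ← Finset.sum_add_distrib, ← Finset.sum_add_distrib, ← Finset.sum_add_distrib,
    ← Finset.sum_add_distrib, Finset.mul_sum, polePval, X2Link.blocks, List.map_map,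
    list_sum_map_range]
  refine Finset.sum_congr rfl fun k hk => ?_
  rw [Finset.mem_range] at hk
  obtain ⟨⟨hN, hS⟩, hr⟩ := h k hk
  simp only [Function.comp_apply, List.map_map]
  rw [list_sum_map_range, list_sum_map_range, list_sum_map_range, list_sum_map_range]
  have ha : ∀ r, r < c.RX → ∀ x : ℝ,
      c.a k r x = phiW ((L.PhiA.getD k []).getD r []) x / (L.N.getD k 0 : ℕ) := by
    intro r hr' x
    rw [← eval_aPolyN_rows]
    exact upolyEval_of_eqScaled _ hN _ _ (hr r hr').1 x
  have hb : ∀ r, r < c.RX → ∀ x : ℝ,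
      c.b k r x = phiW ((L.PhiB.getD k []).getD r []) x / (L.N.getD k 0 : ℕ) := by
    intro r hr' x
    rw [← eval_bPolyN_rows]
    exact upolyEval_of_eqScaled _ hN _ _ (hr r hr').2 x
  have hN' : ((L.N.getD k 0 : ℕ) : ℝ) ≠ 0 := by exact_mod_cast hN.ne'
  have hS' : ((L.S.getD k 0 : ℕ) : ℝ) * (cfac3 k : ℝ) * ((L.N.getD k 0 : ℕ) : ℝ) ^ 2 = (DK : ℝ) := by
    exact_mod_cast hS
  rw [← hS']
  simp only [Finset.mul_sum, Finset.sum_mul, mul_add, ← Finset.sum_add_distrib]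
  refine Finset.sum_congr rfl fun r hr' => ?_
  rw [Finset.mem_range] at hr'
  simp only [Function.comp_apply]
  rw [ha r hr' 1, ha r hr' t, hb r hr' (-u), hb r hr' (-v), cast_sum_eq_phiW_one]
  field_simp

/-- **The triple link**: under `linkCheckX`, the triple expansion evaluates to `DK · S₃`. [folklore] -/
theorem poleSval_link (c : X2Cert) (L : X2Link) (DK : ℕ) (h : linkCheckX c L DK = true)
    (u v t : ℝ) : poleSval (L.blocks c.KX c.RX) u v t = (DK : ℝ) * c.tripleSym u v t := by
  simp only [linkCheckX, List.all_eq_true, List.mem_range, Bool.and_eq_true, decide_eq_true_eq] at h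
  rw [X2Cert.tripleSym, X2Cert.S11, poleKernel3, poleKernel3, poleKernel3,
    ← Finset.sum_add_distrib, ← Finset.sum_add_distrib, Finset.mul_sum, poleSval, X2Link.blocks,
    List.map_map, list_sum_map_range]
  refine Finset.sum_congr rfl fun k hk => ?_
  rw [Finset.mem_range] at hk
  obtain ⟨⟨hN, hS⟩, hr⟩ := h k hk
  simp only [Function.comp_apply, List.map_map]
  rw [list_sum_map_range, list_sum_map_range, list_sum_map_range]
  have ha : ∀ r, r < c.RX → ∀ x : ℝ,
      c.a k r x = phiW ((L.PhiA.getD k []).getD r []) x / (L.N.getD k 0 : ℕ) := by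
    intro r hr' x
    rw [← eval_aPolyN_rows]
    exact upolyEval_of_eqScaled _ hN _ _ (hr r hr').1 x
  have hN' : ((L.N.getD k 0 : ℕ) : ℝ) ≠ 0 := by exact_mod_cast hN.ne'
  have hS' : ((L.S.getD k 0 : ℕ) : ℝ) * (cfac3 k : ℝ) * ((L.N.getD k 0 : ℕ) : ℝ) ^ 2 = (DK : ℝ) := by
    exact_mod_cast hS
  rw [← hS']
  simp only [Finset.mul_sum, Finset.sum_mul, mul_add, ← Finset.sum_add_distrib]
  refine Finset.sum_congr rfl fun r hr' => ?_
  rw [Finset.mem_range] at hr'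
  simp only [Function.comp_apply]
  rw [ha r hr' u, ha r hr' v, ha r hr' t]
  field_simp


/-! ### The integer certificate -/

/-- An X2 SOS certificate in integers (see the module docstring for the semantics). [folklore] -/
structure X2SOSCert where
  /-- `u₀ = -p₀/q₀` -/
  p0 : ℕ
  /-- see `p0` -/
  q0 : ℕ
  /-- dyadic scale of `P'`, `S₃'` and of the constants -/
  B0 : ℕ
  /-- (II): `2^B0 ·` the certified constant (`P' ≤ CI2/2^B0`, negative) -/
  CI2 : ℤ
  /-- (II): bridge slack `Σ|2^B0 XI - DK PpI|` -/
  delB2 : ℕ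
  /-- (II): identity scale -/
  lam2 : ℕ
  /-- `2^B0 · P'` -/
  PpI : SPoly
  /-- (II): residual slack -/
  c2 : ℕ
  /-- Gram expansion, multiplier `1` of (II) -/
  E0 : SPoly
  /-- Gram expansion, multiplier `m_u + m_v` -/
  E1 : SPoly
  /-- Gram expansion, multiplier `m_u m_v` -/
  E2 : SPoly
  /-- Gram expansion, multiplier `m_t` -/
  E3 : SPoly
  /-- Gram expansion, multiplier `gram` -/
  E4 : SPoly
  /-- (III): `2^B0 ·` the certified constant (`S₃' ≤ CI3/2^B0`) -/
  CI3 : ℤ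
  /-- (III): bridge slack `Σ|2^B0 SI - DK SpI|` -/
  delB3 : ℕ
  /-- (III): identity scale -/
  lam3 : ℕ
  /-- `2^B0 · S₃'` -/
  SpI : SPoly
  /-- (III): residual slack -/
  c3 : ℕ
  /-- Gram expansion, multiplier `1` of (III) -/
  R0 : SPoly
  /-- Gram expansion, multiplier `n_u + n_v` -/
  R1 : SPoly
  /-- Gram expansion, multiplier `n_u n_v` -/
  R2 : SPoly
  /-- Gram expansion, multiplier `m_t` -/
  R3 : SPoly
  /-- Gram expansion, multiplier `gram` -/
  R4 : SPoly

namespace X2SOSCert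

/-- `m_u = (q₀u + p₀)(1 - u)`. [folklore] -/
def mIu (S : X2SOSCert) : SPoly :=
  [(⟨0, 0, 0⟩, (S.p0 : ℤ)), (⟨1, 0, 0⟩, (S.q0 : ℤ) - S.p0), (⟨2, 0, 0⟩, -(S.q0 : ℤ))]

/-- `eval mIu = (q₀u + p₀)(1 - u)`. [folklore] -/
theorem eval_mIu (S : X2SOSCert) (u v t : ℝ) :
    eval S.mIu u v t = ((S.q0 : ℝ) * u + S.p0) * (1 - u) := by
  simp [mIu, eval, Mono.eval]; ring

/-- Target of (II): `lam2 · (CI2 - PpI)`. [folklore] -/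
def target2 (S : X2SOSCert) : SPoly := smul (S.lam2 : ℤ) (C S.CI2 ++ neg S.PpI)

/-- Sum-of-squares side of (II). [folklore] -/
def rhs2 (S : X2SOSCert) : SPoly :=
  mergeAll [S.E0, mulN (S.mIu ++ permBAC S.mIu) S.E1, mulN (mulN S.mIu (permBAC S.mIu)) S.E2,
    mulN ptT S.E3, mulN p4 S.E4]

/-- The check of (II): `target2 - rhs2 - c2 ≡ 0 (± c2)`. [folklore] -/
def check2 (S : X2SOSCert) : Bool :=
  residualBound (mergeAll [S.target2, neg S.rhs2, neg (C (S.c2 : ℤ))]) S.c2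

/-- Target of (III): `lam3 · (CI3 - SpI)`. [folklore] -/
def target3 (S : X2SOSCert) : SPoly := smul (S.lam3 : ℤ) (C S.CI3 ++ neg S.SpI)

/-- Sum-of-squares side of (III) (`n_u = (1+u)(1-2u)` etc.). [folklore] -/
def rhs3 (S : X2SOSCert) : SPoly :=
  mergeAll [S.R0, mulN (ptU ++ ptV) S.R1, mulN (mulN ptU ptV) S.R2, mulN ptT S.R3, mulN p4 S.R4]

/-- The check of (III): `target3 - rhs3 - c3 ≡ 0 (± c3)`. [folklore] -/
def check3 (S : X2SOSCert) : Bool :=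
  residualBound (mergeAll [S.target3, neg S.rhs3, neg (C (S.c3 : ℤ))]) S.c3

/-- Bridge of (II) between the exact expansion `XI` (`= DK·P`) and `PpI` (`= 2^B0 P'`):
`Σ|2^B0 XI - DK PpI| ≤ delB2`. [folklore] -/
def bridge2 (S : X2SOSCert) (DK : ℕ) (XI : SPoly) : Bool :=
  residualBound (smul (2 ^ S.B0 : ℤ) XI ++ neg (smul (DK : ℤ) S.PpI)) S.delB2

/-- Bridge of (III) between the exact expansion `SI` (`= DK·S₃`) and `SpI`. [folklore] -/
def bridge3 (S : X2SOSCert) (DK : ℕ) (SI : SPoly) : Bool :=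
  residualBound (smul (2 ^ S.B0 : ℤ) SI ++ neg (smul (DK : ℤ) S.SpI)) S.delB3

/-- Side conditions for `IneqII … lam`: `0 < q₀`, `p₀ ≤ q₀`, `c.u₀ = -p₀/q₀`, `0 < DK`, `0 < lam2`,
and `lam · DK · 2^B0 ≤ -(DK · CI2 + delB2)`. [folklore] -/
def side2 (S : X2SOSCert) (c : X2Cert) (DK : ℕ) (lam : ℚ) : Bool :=
  decide (0 < S.q0) && decide (S.p0 ≤ S.q0) && decide (c.u0 = -(S.p0 : ℚ) / S.q0) && decide (0 < DK) &&
    decide (0 < S.lam2) &&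
    decide (lam * ((DK * 2 ^ S.B0 : ℕ) : ℚ) ≤ -((DK : ℚ) * S.CI2 + S.delB2))

/-- Side conditions for `IneqIII … eps3`: `0 < DK`, `0 < lam3`, `DK · CI3 + delB3 ≤ eps3 · DK · 2^B0`.
[folklore] -/
def side3 (S : X2SOSCert) (DK : ℕ) (eps3 : ℚ) : Bool :=
  decide (0 < DK) && decide (0 < S.lam3) &&
    decide ((DK : ℚ) * S.CI3 + S.delB3 ≤ eps3 * ((DK * 2 ^ S.B0 : ℕ) : ℚ))

end X2SOSCert

end Summit.Ventures.Crystal3D.X2SOS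

end
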